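import Summits.QuantumFields.BalabanUV.Beta.D1BFx.GhostStencilDivergence
import Summits.QuantumFields.BalabanUV.Beta.D1BFx.FrozenAveragingWard

/-!
# `BalabanUV.Beta.D1BFx.FrozenCommutatorMass` — road «BF-x» for binder row D1, slot (K), junction (J3), ROUTE M of TB5-1′ ((C3) by the Ward route),
# FILE D1: **THE MASSES OF THE FROZEN-AVERAGING COMMUTATORS** `[P_a, f̂] (x,z) = (f z − f x)·a·n⁻⁴·1[blk x = blk z]` and
# `[[P_a, f̂′], f̂]` for LOCALISED `f`, `f′` — product majorants, no block combinatorics: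
# centred σ-mass of `[P_a, f̂]` `≤ |a|·n⁻⁴·(2·Cf·e^{2nδ})·Zl 4 (δ∕2 − σ)²` (`σ ≤ δ∕4`), plain mass of `[[P_a, f̂′], f̂]`
# `≤ |a|·n⁻⁴·(2·Cf·e^{2nδ})·(2·Cf′·e^{2nδ})·Zl 4 (δ∕4)²·e^{−(δ∕4)·|c − c′|₁}` — the letters FILE D2 feeds to g18's `GhostWordFamilies`.

HONEST DEPENDENCY (cell records, verbatim): «continuum YM on T⁴ ⇐ BetaPertH ∧ nine spine estimates (0/9 proved); BetaPertH ⇐ (D1) ∧ (D4) ∧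
CAP+tail; G-an2-4 gates asym, D1 and NE2/3/4.»  HONEST FRAMING (cell contract, verbatim): «discharging `BetaPertH` makes Bałaban's UV stability
UNCONDITIONAL — a real constructive-QFT result; it is NOT the continuum limit and NOT the Clay problem.»  THIS MODULE DISCHARGES NOTHING of (K),
of D1 or of the wall: [folklore] bookkeeping over OUR block projector.  No definition, no `def … : Prop`, nothing cited, 0 sorry.  0 root-level binders
of row D1 discharged; (J3) DISPLAYED; (K) NOT closed; NOT D1, NOT `BetaPertH`, NOT continuum, NOT Clay.
ABSOLUTE RULE (cell charter, verbatim): «No internally-minted statement may enter as a cited fact. Every hypothesis is either kernel-proved in this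
package or a verbatim quotation of a PUBLISHED theorem with page reference. The manuscript(s) under audit are NOT citable for their own disputed
steps — they are the thing under adjudication; programme-internal (2001/route/tribunal) claims are never citable.»
Unit `b2b-balaban-beta-d1-formalise-leaf-04` (gen 22), D1 formalisation swarm leaf prover 04, road «BF-x»; ROUTE M (C3) by the Ward route, FILE D1 (journal [D1LEAF04-G22-*]).
-/

noncomputable section

namespace Summit.QuantumFields.BalabanUV.Beta.D1BFx.FrozenCommutatorMass

open Finset
open scoped BigOperators
open Literature.MathematicalPhysics.QuantumFieldTheory.Balaban1983to89
open Literature.MathematicalPhysics.QuantumFieldTheory.Balaban1983to89.Beta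
open B12Sec2to5 (l1 l1_nonneg)
open B6QGQLower276 (blk sameBlk)
open ExpKernelCalculus (Site MKer Zl Zl_nonneg summable_exp_shift' tsum_exp_shift' l1_sub_triangle l1_sub_symm)
open Summit.QuantumFields.BalabanUV.Beta.D1BFx.GhostStencil (l1_sub_le_of_blk_eq)
open Summit.QuantumFields.BalabanUV.Beta.D1BFx.FrozenAveragingWard (env_const_nonneg)

variable (n : ℕ) [NeZero n] (a : ℝ)

/-! ## §1 The envelope of one factor moves to the block-mate -/

section OneFunction

variable {f : Site 4 → ℝ} {c : Site 4} {Cf δ : ℝ} (hδ : 0 ≤ δ) (hf : ∀ x, |f x| ≤ Cf * Real.exp (-δ * l1 (x - c)))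
include hδ hf

/-- [folklore] **A LOCALISED FUNCTION ON A BLOCK PAIR IS A PRODUCT OF HALF-ENVELOPES**: if `blk x = blk z` then
`|f x| ≤ Cf·e^{2nδ}·e^{−(δ∕2)|x − c|₁}·e^{−(δ∕2)|z − c|₁}` (`|z − c|₁ ≤ |x − c|₁ + 4n`). -/
theorem abs_le_half_env {x z : Site 4} (h : blk (n - 1) x = blk (n - 1) z) :
    |f x| ≤ Cf * Real.exp (2 * n * δ) * Real.exp (-(δ / 2) * l1 (x - c)) * Real.exp (-(δ / 2) * l1 (z - c)) := by
  have hC := env_const_nonneg hf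
  have hxz : l1 (x - z) ≤ 4 * (n : ℝ) := l1_sub_le_of_blk_eq n h
  have t : l1 (z - c) ≤ l1 (z - x) + l1 (x - c) := l1_sub_triangle z x c
  rw [l1_sub_symm z x] at t
  refine (hf x).trans ?_
  rw [mul_assoc, mul_assoc, ← Real.exp_add, ← Real.exp_add]
  exact mul_le_mul_of_nonneg_left (Real.exp_le_exp.2 (by nlinarith [l1_nonneg (x - c)])) hC

/-- [folklore] **THE CENTRED σ-MASS OF THE FROZEN COMMUTATOR** `[P_a, f̂] (x,z) = (f z − f x)·(a·n⁻⁴·1[blk x = blk z])`, `σ ≤ δ∕4`, `0 < δ`: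
summable and `≤ |a|·n⁻⁴·(2·Cf·e^{2nδ})·Zl 4 (δ∕2 − σ)²` (product majorant `e^{−(δ∕2 − σ)|x − c|₁}·e^{−(δ∕2 − σ)|z − c|₁}`). -/
theorem mass_frozenComm_le (hδ' : 0 < δ) {σ : ℝ} (hσ : σ ≤ δ / 4) :
    (Summable fun p : Site 4 × Site 4 => ∑ g : Unit, ∑ b : Unit,
        |(fun x z (_ _ : Unit) => (f z - f x) * (a / (n : ℝ) ^ 4 * sameBlk (n - 1) x z)) p.1 p.2 g b|
          * Real.exp (σ * (l1 (p.1 - c) + l1 (p.2 - c)))) ∧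
      ∑' p : Site 4 × Site 4, ∑ g : Unit, ∑ b : Unit,
        |(fun x z (_ _ : Unit) => (f z - f x) * (a / (n : ℝ) ^ 4 * sameBlk (n - 1) x z)) p.1 p.2 g b|
          * Real.exp (σ * (l1 (p.1 - c) + l1 (p.2 - c)))
        ≤ |a| / (n : ℝ) ^ 4 * (2 * Cf * Real.exp (2 * n * δ)) * Zl 4 (δ / 2 - σ) ^ 2 := by
  have hC := env_const_nonneg hf
  have hr : 0 < δ / 2 - σ := by linarith
  set A : ℝ := |a| / (n : ℝ) ^ 4 * (2 * Cf * Real.exp (2 * n * δ)) with hA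
  have hA0 : 0 ≤ A := by positivity
  set E : Site 4 → ℝ := fun x => Real.exp (-(δ / 2 - σ) * l1 (x - c)) with hE
  have hEs : Summable E := summable_exp_shift' hr c
  have hEt : ∑' x, E x = Zl 4 (δ / 2 - σ) := tsum_exp_shift' c
  have hE0 : ∀ x, 0 ≤ E x := fun x => (Real.exp_pos _).le
  -- the product majorant
  set g : Site 4 × Site 4 → ℝ := fun p => A * (E p.1 * E p.2) with hg
  have hgs : Summable g := (hEs.mul_of_nonneg hEs hE0 hE0).mul_left A
  have hgt : ∑' p, g p = A * Zl 4 (δ / 2 - σ) ^ 2 := by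
    rw [hg, tsum_mul_left, ← hEs.tsum_mul_tsum hEs (hEs.mul_of_nonneg hEs hE0 hE0), hEt, sq]
  have hnn : ∀ p : Site 4 × Site 4, 0 ≤ ∑ g : Unit, ∑ b : Unit,
      |(fun x z (_ _ : Unit) => (f z - f x) * (a / (n : ℝ) ^ 4 * sameBlk (n - 1) x z)) p.1 p.2 g b| * Real.exp (σ * (l1 (p.1 - c) + l1 (p.2 - c))) :=
    fun p => Finset.sum_nonneg fun _ _ => Finset.sum_nonneg fun _ _ => by positivity
  have hle : ∀ p : Site 4 × Site 4, ∑ g : Unit, ∑ b : Unit,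
      |(fun x z (_ _ : Unit) => (f z - f x) * (a / (n : ℝ) ^ 4 * sameBlk (n - 1) x z)) p.1 p.2 g b| * Real.exp (σ * (l1 (p.1 - c) + l1 (p.2 - c)))
        ≤ g p := by
    rintro ⟨x, z⟩
    rw [Fintype.sum_unique, Fintype.sum_unique]
    show |(f z - f x) * (a / (n : ℝ) ^ 4 * sameBlk (n - 1) x z)| * Real.exp (σ * (l1 (x - c) + l1 (z - c))) ≤ A * (E x * E z)
    by_cases h : blk (n - 1) x = blk (n - 1) z
    · have hs : sameBlk (n - 1) x z = 1 := by unfold sameBlk; rw [if_pos h]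
      have hx := abs_le_half_env n hδ hf h
      have hz := abs_le_half_env n hδ hf h.symm
      rw [hs, mul_one, abs_mul, abs_div, abs_of_nonneg (by positivity : (0:ℝ) ≤ (n : ℝ) ^ 4)]
      have hsum : |f z - f x| ≤ 2 * (Cf * Real.exp (2 * n * δ) * Real.exp (-(δ / 2) * l1 (x - c)) * Real.exp (-(δ / 2) * l1 (z - c))) := by
        calc |f z - f x| ≤ |f z| + |f x| := abs_sub _ _
          _ ≤ _ := by nlinarith [hx, hz, mul_comm (Real.exp (-(δ / 2) * l1 (z - c))) (Real.exp (-(δ / 2) * l1 (x - c)))]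
      have key : |f z - f x| * (|a| / (n : ℝ) ^ 4) * Real.exp (σ * (l1 (x - c) + l1 (z - c)))
          ≤ 2 * (Cf * Real.exp (2 * n * δ) * Real.exp (-(δ / 2) * l1 (x - c)) * Real.exp (-(δ / 2) * l1 (z - c))) * (|a| / (n : ℝ) ^ 4)
            * Real.exp (σ * (l1 (x - c) + l1 (z - c))) :=
        mul_le_mul_of_nonneg_right (mul_le_mul_of_nonneg_right hsum (by positivity)) (Real.exp_pos _).le
      refine (le_of_eq (by ring)).trans (key.trans (le_of_eq ?_))
      rw [hA, hE]
      simp only []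
      have e1 : Real.exp (-(δ / 2) * l1 (x - c)) * Real.exp (-(δ / 2) * l1 (z - c)) * Real.exp (σ * (l1 (x - c) + l1 (z - c)))
          = Real.exp (-(δ / 2 - σ) * l1 (x - c)) * Real.exp (-(δ / 2 - σ) * l1 (z - c)) := by
        rw [← Real.exp_add, ← Real.exp_add, ← Real.exp_add]; ring_nf
      calc 2 * (Cf * Real.exp (2 * n * δ) * Real.exp (-(δ / 2) * l1 (x - c)) * Real.exp (-(δ / 2) * l1 (z - c))) * (|a| / (n : ℝ) ^ 4)
            * Real.exp (σ * (l1 (x - c) + l1 (z - c)))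
          = |a| / (n : ℝ) ^ 4 * (2 * Cf * Real.exp (2 * n * δ))
            * (Real.exp (-(δ / 2) * l1 (x - c)) * Real.exp (-(δ / 2) * l1 (z - c)) * Real.exp (σ * (l1 (x - c) + l1 (z - c)))) := by ring
        _ = _ := by rw [e1]
    · have hs : sameBlk (n - 1) x z = 0 := by unfold sameBlk; rw [if_neg h]
      rw [hs, mul_zero, mul_zero, abs_zero, zero_mul]
      exact mul_nonneg hA0 (mul_nonneg (hE0 x) (hE0 z))
  have hsum := Summable.of_nonneg_of_le hnn hle hgs
  exact ⟨hsum, (hsum.tsum_le_tsum hle hgs).trans (le_of_eq hgt)⟩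

end OneFunction

/-! ## §2 The double commutator: plain mass with the product of the two envelopes -/

section TwoFunctions

variable {f f' : Site 4 → ℝ} {c c' : Site 4} {Cf Cf' δ : ℝ} (hδ : 0 < δ)
  (hf : ∀ x, |f x| ≤ Cf * Real.exp (-δ * l1 (x - c))) (hf' : ∀ x, |f' x| ≤ Cf' * Real.exp (-δ * l1 (x - c')))
include hδ hf hf'

/-- [folklore] **THE PLAIN MASS OF THE DOUBLE FROZEN COMMUTATOR** `[[P_a, f̂′], f̂] (x,z) = (f z − f x)·((f′ z − f′ x)·(a·n⁻⁴·1[blk x = blk z]))`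
for two functions localised at `c`, `c′` with the same rate `δ > 0`: summable and
`≤ |a|·n⁻⁴·(4·Cf·Cf′·e^{4nδ})·e^{−(δ∕2)|c − c′|₁}·Zl 4 (δ∕4)²` — the overlap of the two envelopes pays the separation of the centres. -/
theorem mass_frozenComm₂_le :
    (Summable fun p : Site 4 × Site 4 => ∑ g : Unit, ∑ b : Unit,
        |(fun x z (_ _ : Unit) => (f z - f x) * ((f' z - f' x) * (a / (n : ℝ) ^ 4 * sameBlk (n - 1) x z))) p.1 p.2 g b|) ∧
      ∑' p : Site 4 × Site 4, ∑ g : Unit, ∑ b : Unit,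
        |(fun x z (_ _ : Unit) => (f z - f x) * ((f' z - f' x) * (a / (n : ℝ) ^ 4 * sameBlk (n - 1) x z))) p.1 p.2 g b|
        ≤ |a| / (n : ℝ) ^ 4 * (4 * Cf * Cf' * Real.exp (4 * n * δ)) * Real.exp (-(δ / 2) * l1 (c - c')) * Zl 4 (δ / 4) ^ 2 := by
  have hC := env_const_nonneg hf
  have hC' := env_const_nonneg hf'
  have hr : 0 < δ / 4 := by linarith
  set A : ℝ := |a| / (n : ℝ) ^ 4 * (4 * Cf * Cf' * Real.exp (4 * n * δ)) * Real.exp (-(δ / 2) * l1 (c - c')) with hA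
  have hA0 : 0 ≤ A := by positivity
  set E : Site 4 → ℝ := fun x => Real.exp (-(δ / 4) * l1 (x - c)) with hE
  have hEs : Summable E := summable_exp_shift' hr c
  have hEt : ∑' x, E x = Zl 4 (δ / 4) := tsum_exp_shift' c
  have hE0 : ∀ x, 0 ≤ E x := fun x => (Real.exp_pos _).le
  set g : Site 4 × Site 4 → ℝ := fun p => A * (E p.1 * E p.2) with hg
  have hgs : Summable g := (hEs.mul_of_nonneg hEs hE0 hE0).mul_left A
  have hgt : ∑' p, g p = A * Zl 4 (δ / 4) ^ 2 := by
    rw [hg, tsum_mul_left, ← hEs.tsum_mul_tsum hEs (hEs.mul_of_nonneg hEs hE0 hE0), hEt, sq]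
  -- one point: the two half-envelopes at `c` and at `c′` overlap at the price of the centres' separation
  have hpt : ∀ x : Site 4, Real.exp (-(δ / 2) * l1 (x - c)) * Real.exp (-(δ / 2) * l1 (x - c'))
      ≤ Real.exp (-(δ / 4) * l1 (c - c')) * E x := by
    intro x
    rw [hE, ← Real.exp_add, ← Real.exp_add]
    refine Real.exp_le_exp.2 ?_
    have t : l1 (c - c') ≤ l1 (c - x) + l1 (x - c') := l1_sub_triangle c x c'
    rw [l1_sub_symm c x] at t
    nlinarith [l1_nonneg (x - c), l1_nonneg (x - c'), hδ.le]
  have hnn : ∀ p : Site 4 × Site 4, 0 ≤ ∑ g : Unit, ∑ b : Unit,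
      |(fun x z (_ _ : Unit) => (f z - f x) * ((f' z - f' x) * (a / (n : ℝ) ^ 4 * sameBlk (n - 1) x z))) p.1 p.2 g b| :=
    fun p => Finset.sum_nonneg fun _ _ => Finset.sum_nonneg fun _ _ => abs_nonneg _
  have hle : ∀ p : Site 4 × Site 4, ∑ g : Unit, ∑ b : Unit,
      |(fun x z (_ _ : Unit) => (f z - f x) * ((f' z - f' x) * (a / (n : ℝ) ^ 4 * sameBlk (n - 1) x z))) p.1 p.2 g b| ≤ g p := by
    rintro ⟨x, z⟩
    rw [Fintype.sum_unique, Fintype.sum_unique]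
    show |(f z - f x) * ((f' z - f' x) * (a / (n : ℝ) ^ 4 * sameBlk (n - 1) x z))| ≤ A * (E x * E z)
    by_cases h : blk (n - 1) x = blk (n - 1) z
    · have hs : sameBlk (n - 1) x z = 1 := by unfold sameBlk; rw [if_pos h]
      have hx := abs_le_half_env n hδ.le hf h
      have hz := abs_le_half_env n hδ.le hf h.symm
      have hx' := abs_le_half_env n hδ.le hf' h
      have hz' := abs_le_half_env n hδ.le hf' h.symm
      -- the two differences
      have d1 : |f z - f x| ≤ 2 * (Cf * Real.exp (2 * n * δ)) * (Real.exp (-(δ / 2) * l1 (x - c)) * Real.exp (-(δ / 2) * l1 (z - c))) := by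
        calc |f z - f x| ≤ |f z| + |f x| := abs_sub _ _
          _ ≤ _ := by nlinarith [hx, hz, mul_comm (Real.exp (-(δ / 2) * l1 (z - c))) (Real.exp (-(δ / 2) * l1 (x - c)))]
      have d2 : |f' z - f' x| ≤ 2 * (Cf' * Real.exp (2 * n * δ)) * (Real.exp (-(δ / 2) * l1 (x - c')) * Real.exp (-(δ / 2) * l1 (z - c'))) := by
        calc |f' z - f' x| ≤ |f' z| + |f' x| := abs_sub _ _
          _ ≤ _ := by nlinarith [hx', hz', mul_comm (Real.exp (-(δ / 2) * l1 (z - c'))) (Real.exp (-(δ / 2) * l1 (x - c')))]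
      rw [hs, mul_one, abs_mul, abs_mul, abs_div, abs_of_nonneg (by positivity : (0:ℝ) ≤ (n : ℝ) ^ 4)]
      have hprod := mul_le_mul d1 (mul_le_mul_of_nonneg_right d2 (by positivity : (0:ℝ) ≤ |a| / (n : ℝ) ^ 4)) (by positivity) (by positivity)
      refine hprod.trans ?_
      have ex := hpt x
      have ez := hpt z
      have e4 : Real.exp (2 * n * δ) * Real.exp (2 * n * δ) = Real.exp (4 * n * δ) := by rw [← Real.exp_add]; ring_nf
      have e2 : Real.exp (-(δ / 4) * l1 (c - c')) * Real.exp (-(δ / 4) * l1 (c - c')) = Real.exp (-(δ / 2) * l1 (c - c')) := by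
        rw [← Real.exp_add]; ring_nf
      calc 2 * (Cf * Real.exp (2 * n * δ)) * (Real.exp (-(δ / 2) * l1 (x - c)) * Real.exp (-(δ / 2) * l1 (z - c)))
            * (2 * (Cf' * Real.exp (2 * n * δ)) * (Real.exp (-(δ / 2) * l1 (x - c')) * Real.exp (-(δ / 2) * l1 (z - c'))) * (|a| / (n : ℝ) ^ 4))
          = |a| / (n : ℝ) ^ 4 * (4 * Cf * Cf' * (Real.exp (2 * n * δ) * Real.exp (2 * n * δ)))
            * ((Real.exp (-(δ / 2) * l1 (x - c)) * Real.exp (-(δ / 2) * l1 (x - c')))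
              * (Real.exp (-(δ / 2) * l1 (z - c)) * Real.exp (-(δ / 2) * l1 (z - c')))) := by ring
        _ ≤ |a| / (n : ℝ) ^ 4 * (4 * Cf * Cf' * (Real.exp (2 * n * δ) * Real.exp (2 * n * δ)))
            * ((Real.exp (-(δ / 4) * l1 (c - c')) * E x) * (Real.exp (-(δ / 4) * l1 (c - c')) * E z)) :=
            mul_le_mul_of_nonneg_left (mul_le_mul ex ez (by positivity) (by positivity)) (by positivity)
        _ = A * (E x * E z) := by rw [hA, e4, ← e2]; ring
    · have hs : sameBlk (n - 1) x z = 0 := by unfold sameBlk; rw [if_neg h]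
      rw [hs, mul_zero, mul_zero, mul_zero, abs_zero]
      exact mul_nonneg hA0 (mul_nonneg (hE0 x) (hE0 z))
  have hsum := Summable.of_nonneg_of_le hnn hle hgs
  exact ⟨hsum, (hsum.tsum_le_tsum hle hgs).trans (le_of_eq hgt)⟩

end TwoFunctions

end Summit.QuantumFields.BalabanUV.Beta.D1BFx.FrozenCommutatorMass

end
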